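import Mathlib
import Literature.MathematicalPhysics.MHD.SolovevFluxSurfaceGGJDerivs
import HarnessLib

/-!
# The transport identity behind surface-averaged force balance on the Lee–Cerfon / PCF Solov'ev family:
# `∂_r (B_p|γ′|) = C_s·R·det(∂_rγ, ∂_tγ) + ∂_t H` along the printed loop (proved, pointwise)

Eighth file of the `lcLoop` series (gridfusion-model-5). For `Ψ = psiLC κ F_B R₀ q₀ a` [Lee–Cerfon 2015 §4.1
(solo2), bib `LeeCerfon2015`] on the printed loop `γ_r(t) = lcLoop R₀ κ r t` (`u = R² = R₀² + 2rR₀cos t`,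
`c = κF_B/(2R₀³q₀)`), the toroidal-current integrand of Freidberg's (6.27) `μ₀I = ∮B_p dℓ` is
`f(r,t) = B_p|γ′| = κ|∇Ψ|²/(2c·u√u)` (`lcLoop_currentIntegrand`), i.e. `f = ω(∂_tγ)` for the 1-form
`ω = (Ψ_R dZ − Ψ_Z dR)/R`. Since `dω = (Δ*Ψ/R) dR∧dZ` and `Δ*Ψ = C_sR²` (`gsOperator_psiLC`,
`C_s = csLC`), the classical transport (Leibniz) formula for the moving loop gives, POINTWISE in `t`,

  `∂_r f(r,t) = C_s·R·det(∂_rγ, ∂_tγ) + ∂_t H(r,t)`,  `H = ω(∂_rγ) = (Ψ_R ∂_rZ − Ψ_Z ∂_rR)/R`,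

with `R·det(∂_rγ, ∂_tγ) = κrR₀²/√u` on this family. THIS FILE proves exactly that, by explicit
differentiation (no appeal to Stokes' theorem): `hasDerivAt_lcCurrentDensity` (`∂_r f = lcCurrentDr`),
`hasDerivAt_lcTransportH` (`∂_t H = lcCurrentDr − C_sκrR₀²/√u` — the identity; the algebra uses only
`sin² = 1 − cos²` and `cos t = (u − R₀²)/(2rR₀)`), and `integral_lcCurrentDr_sub`
(`∫₀^{2π} (∂_r f − C_sκrR₀²/√u) dt = H(2π) − H(0) = 0`). The companion file
`SolovevFluxSurfaceForceBalance.lean` integrates it: `dI/dr = C_s·2cR₀²r·∫₀^{2π} w dt`, i.e.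
`dI/dΨ = C_sV′/(2π)` — the surface-averaged force balance `p′V′ + I′Ψ′ − K′Φ′ = 0` of the GGJ data
(`Mercier.FluxForm.SurfaceData.IsForceBalanced`, gridfusion-lit-3) for this family.
HONEST FRAMING: exact real analysis about MODEL objects; nothing here is a stability claim.
Typer/prover: gridfusion-model-5 (g3), 2026-08-27.
-/

noncomputable section

namespace Literature.MathematicalPhysics.MHD.Solovev

open GradShafranov FluxGeometry _root_.Real MeasureTheory intervalIntegral _root_.Set

/-! ## The current integrand, its `r`-derivative, and the transport potential `H` -/

/-- The toroidal-current integrand along the loop, `f = B_p|γ′| = κ|∇Ψ|²/(2c·u√u)` (the right-hand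
side of `lcLoop_currentIntegrand`; `μ₀I(r) = ∫₀^{2π} f dt`, Freidberg (6.27)). [cite: Freidberg2014, §6.3.3 eq. (6.27)] -/
def lcCurrentDensity (κ FB R₀ q₀ r t : ℝ) : ℝ :=
  κ * lcGradSq κ FB R₀ q₀ r t
    / (2 * (κ * FB / (2 * R₀ ^ 3 * q₀)) * lcU R₀ r t * Real.sqrt (lcU R₀ r t))

/-- `∂|∇Ψ|²/∂r` along the family (product rule on `lcGradSq = (2crR₀)²·(u sin²t/κ² + P²/u)`,
`P = u cos t + rR₀ sin²t`, `∂u/∂r = 2R₀cos t`, `∂P/∂r = 2R₀cos²t + R₀sin²t`). [cite: LeeCerfon2015, §4.1 (boundary parametrisation)] -/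
def lcGradSqDr (κ FB R₀ q₀ r t : ℝ) : ℝ :=
  (2 * (κ * FB / (2 * R₀ ^ 3 * q₀)) * R₀) ^ 2
    * (2 * r * (lcU R₀ r t * Real.sin t ^ 2 / κ ^ 2)
        + r ^ 2 * (2 * R₀ * Real.cos t * Real.sin t ^ 2 / κ ^ 2)
      + (2 * r * ((lcU R₀ r t * Real.cos t + r * R₀ * Real.sin t ^ 2) ^ 2 / lcU R₀ r t)
        + r ^ 2 * ((2 * (lcU R₀ r t * Real.cos t + r * R₀ * Real.sin t ^ 2)
              * (2 * R₀ * Real.cos t * Real.cos t + R₀ * Real.sin t ^ 2) * lcU R₀ r t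
            - (lcU R₀ r t * Real.cos t + r * R₀ * Real.sin t ^ 2) ^ 2 * (2 * R₀ * Real.cos t))
            / lcU R₀ r t ^ 2)))

/-- `∂f/∂r = κ/(2c)·(∂_r|∇Ψ|²·(u√u)⁻¹ + |∇Ψ|²·∂_r(u√u)⁻¹)` (`∂_r(u√u)⁻¹ = lcQKernelDr`).
[cite: Freidberg2014, §6.3.3 eq. (6.27)] -/
def lcCurrentDr (κ FB R₀ q₀ r t : ℝ) : ℝ :=
  κ / (2 * (κ * FB / (2 * R₀ ^ 3 * q₀)))
    * (lcGradSqDr κ FB R₀ q₀ r t * (lcU R₀ r t * Real.sqrt (lcU R₀ r t))⁻¹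
      + lcGradSq κ FB R₀ q₀ r t * lcQKernelDr R₀ r t)

/-- The TRANSPORT POTENTIAL `H = ω(∂_rγ) = (Ψ_R ∂_rZ − Ψ_Z ∂_rR)/R` along the loop, explicitly
`H = 2crR₀² sin t·[κP(u − rR₀cos t)/u² − cos t/κ]/√u` (`Ψ_R = 2crR₀P/√u`, `Ψ_Z = 2crR₀√u sin t/κ`,
`∂_rR = R₀cos t/√u`, `∂_rZ = κR₀ sin t(u − rR₀cos t)/(u√u)`). [cite: LeeCerfon2015, §4.1 (boundary parametrisation)] -/
def lcTransportH (κ FB R₀ q₀ r t : ℝ) : ℝ :=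
  2 * (κ * FB / (2 * R₀ ^ 3 * q₀)) * r * R₀ ^ 2 * Real.sin t
    * (κ * (lcU R₀ r t * Real.cos t + r * R₀ * Real.sin t ^ 2) * (lcU R₀ r t - r * R₀ * Real.cos t)
        / lcU R₀ r t ^ 2 - Real.cos t / κ)
    / Real.sqrt (lcU R₀ r t)

/-- `f` is the right-hand side of `lcLoop_currentIntegrand`: `B_p|γ′| = lcCurrentDensity`.
[cite: Freidberg2014, §6.3.3 eq. (6.27)] -/
theorem lcLoop_currentIntegrand_eq {R₀ κ FB q₀ r : ℝ} (hR₀ : 0 < R₀) (hκ : 0 < κ) (hFB : 0 < FB)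
    (hq₀ : 0 < q₀) (hr : 0 < r) (h2r : 2 * r < R₀) (a t : ℝ) :
    fieldBpol (psiLC κ FB R₀ q₀ a) (lcLoop R₀ κ r t).1 (lcLoop R₀ κ r t).2 * speed (lcLoop R₀ κ r) t
      = lcCurrentDensity κ FB R₀ q₀ r t :=
  lcLoop_currentIntegrand hR₀ hκ hFB hq₀ hr h2r a t

/-- `∂_rR = R₀cos t/√u` along the family. [cite: LeeCerfon2015, §4.1 (boundary parametrisation)] -/
theorem hasDerivAt_lcLoop_fst_radius {R₀ r : ℝ} (κ t : ℝ) (hu : 0 < lcU R₀ r t) :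
    HasDerivAt (fun ρ => (lcLoop R₀ κ ρ t).1) (R₀ * Real.cos t / Real.sqrt (lcU R₀ r t)) r := by
  have h := (hasDerivAt_lcU_radius R₀ r t).sqrt hu.ne'
  refine h.congr_deriv ?_
  field_simp

/-- `∂_rZ = κR₀ sin t·(u − rR₀cos t)/(u√u)` along the family. [cite: LeeCerfon2015, §4.1 (boundary parametrisation)] -/
theorem hasDerivAt_lcLoop_snd_radius {R₀ r : ℝ} (κ t : ℝ) (hu : 0 < lcU R₀ r t) :
    HasDerivAt (fun ρ => (lcLoop R₀ κ ρ t).2)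
      (κ * R₀ * Real.sin t * (lcU R₀ r t - r * R₀ * Real.cos t)
        / (lcU R₀ r t * Real.sqrt (lcU R₀ r t))) r := by
  have hs : 0 < Real.sqrt (lcU R₀ r t) := Real.sqrt_pos.2 hu
  have h1 : HasDerivAt (fun ρ => κ * ρ * R₀ * Real.sin t) (κ * 1 * R₀ * Real.sin t) r :=
    (((hasDerivAt_id' (x := r)).const_mul κ).mul_const R₀).mul_const (Real.sin t)
  have h2 := (hasDerivAt_lcU_radius R₀ r t).sqrt hu.ne'
  have h := h1.div h2 hs.ne'
  refine h.congr_deriv ?_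
  set s := Real.sqrt (lcU R₀ r t) with hs_def
  have hu' : lcU R₀ r t = s ^ 2 := by rw [hs_def, Real.sq_sqrt hu.le]
  rw [hu']
  field_simp

/-- **`H` is what it claims to be:** `H = (Ψ_R ∂_rZ − Ψ_Z ∂_rR)/R` with the tree's `dR/dZ` of `psiLC`
along the loop and the `r`-derivatives of the loop coordinates. [cite: LeeCerfon2015, §4.1 (boundary parametrisation)] -/
theorem lcTransportH_eq {R₀ κ FB q₀ r : ℝ} (hR₀ : 0 < R₀) (hκ : 0 < κ) (hr : 0 ≤ r) (h2r : 2 * r < R₀)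
    (a t : ℝ) :
    lcTransportH κ FB R₀ q₀ r t
      = (dR (psiLC κ FB R₀ q₀ a) (lcLoop R₀ κ r t).1 (lcLoop R₀ κ r t).2
            * (κ * R₀ * Real.sin t * (lcU R₀ r t - r * R₀ * Real.cos t)
                / (lcU R₀ r t * Real.sqrt (lcU R₀ r t)))
          - dZ (psiLC κ FB R₀ q₀ a) (lcLoop R₀ κ r t).1 (lcLoop R₀ κ r t).2
            * (R₀ * Real.cos t / Real.sqrt (lcU R₀ r t)))
          / (lcLoop R₀ κ r t).1 := by
  have hu := lcU_pos hR₀ hr h2r t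
  have h1 : (lcLoop R₀ κ r t).1 = Real.sqrt (lcU R₀ r t) := rfl
  rw [dR_psiLC_lcLoop hR₀ hκ.ne' hr h2r, dZ_psiLC_lcLoop hR₀ hκ.ne' hr h2r, h1]
  unfold lcTransportH
  set s := Real.sqrt (lcU R₀ r t) with hs_def
  have hs : 0 < s := Real.sqrt_pos.2 hu
  have hu' : lcU R₀ r t = s ^ 2 := by rw [hs_def, Real.sq_sqrt hu.le]
  rw [hu']
  field_simp

/-! ## `∂f/∂r` -/

/-- `∂_r|∇Ψ|² = lcGradSqDr` along the family (`u > 0`). [cite: LeeCerfon2015, §4.1 (boundary parametrisation)] -/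
theorem hasDerivAt_lcGradSq_radius {κ FB R₀ q₀ r t : ℝ} (hu : 0 < lcU R₀ r t) :
    HasDerivAt (fun ρ => lcGradSq κ FB R₀ q₀ ρ t) (lcGradSqDr κ FB R₀ q₀ r t) r := by
  have hU := hasDerivAt_lcU_radius R₀ r t
  have hρ2 : HasDerivAt (fun ρ : ℝ => ρ ^ 2) (2 * r) r := by
    simpa using hasDerivAt_pow 2 r
  have hP : HasDerivAt (fun ρ => lcU R₀ ρ t * Real.cos t + ρ * R₀ * Real.sin t ^ 2)
      (2 * R₀ * Real.cos t * Real.cos t + R₀ * Real.sin t ^ 2) r := by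
    have h := (hU.mul_const (Real.cos t)).add
      (((hasDerivAt_id' (x := r)).mul_const R₀).mul_const (Real.sin t ^ 2))
    exact h.congr_deriv (by ring)
  have h1 : HasDerivAt (fun ρ => ρ ^ 2 * (lcU R₀ ρ t * Real.sin t ^ 2 / κ ^ 2))
      (2 * r * (lcU R₀ r t * Real.sin t ^ 2 / κ ^ 2)
        + r ^ 2 * (2 * R₀ * Real.cos t * Real.sin t ^ 2 / κ ^ 2)) r :=
    hρ2.mul ((hU.mul_const (Real.sin t ^ 2)).div_const (κ ^ 2))
  have h2 : HasDerivAt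
      (fun ρ => ρ ^ 2 * ((lcU R₀ ρ t * Real.cos t + ρ * R₀ * Real.sin t ^ 2) ^ 2 / lcU R₀ ρ t))
      (2 * r * ((lcU R₀ r t * Real.cos t + r * R₀ * Real.sin t ^ 2) ^ 2 / lcU R₀ r t)
        + r ^ 2 * ((↑(2 : ℕ) * (lcU R₀ r t * Real.cos t + r * R₀ * Real.sin t ^ 2) ^ (2 - 1)
              * (2 * R₀ * Real.cos t * Real.cos t + R₀ * Real.sin t ^ 2) * lcU R₀ r t
            - (lcU R₀ r t * Real.cos t + r * R₀ * Real.sin t ^ 2) ^ 2 * (2 * R₀ * Real.cos t))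
            / lcU R₀ r t ^ 2)) r :=
    hρ2.mul ((hP.pow 2).div hU hu.ne')
  have h := (h1.add h2).const_mul ((2 * (κ * FB / (2 * R₀ ^ 3 * q₀)) * R₀) ^ 2)
  have h' : HasDerivAt (fun ρ => lcGradSq κ FB R₀ q₀ ρ t) _ r :=
    h.congr_of_eventuallyEq (Filter.Eventually.of_forall fun ρ => by
      simp only [Pi.add_apply]; unfold lcGradSq; ring)
  refine h'.congr_deriv ?_
  unfold lcGradSqDr
  norm_num

/-- **`∂f/∂r = lcCurrentDr`** along the family (`u > 0`). [cite: Freidberg2014, §6.3.3 eq. (6.27)] -/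
theorem hasDerivAt_lcCurrentDensity {κ FB R₀ q₀ r t : ℝ} (hu : 0 < lcU R₀ r t) :
    HasDerivAt (fun ρ => lcCurrentDensity κ FB R₀ q₀ ρ t) (lcCurrentDr κ FB R₀ q₀ r t) r := by
  have h := ((hasDerivAt_lcGradSq_radius (κ := κ) (FB := FB) (q₀ := q₀) hu).mul
    (hasDerivAt_lcQKernel hu)).const_mul (κ / (2 * (κ * FB / (2 * R₀ ^ 3 * q₀))))
  exact h.congr_of_eventuallyEq (Filter.Eventually.of_forall fun ρ => by
    simp only [Pi.mul_apply]; unfold lcCurrentDensity; ring)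

/-! ## `∂H/∂t` and the transport identity -/

/-- **THE TRANSPORT IDENTITY.** Along the family, for `0 < r < R₀/2` (`κ, F_B, q₀, R₀ > 0`),
`∂_t H(r,t) = ∂_r f(r,t) − C_s·κrR₀²/√u` with `C_s = csLC κ F_B R₀ q₀` — i.e.
`∂_r(ω(∂_tγ)) − ∂_t(ω(∂_rγ)) = dω(∂_rγ,∂_tγ) = (Δ*Ψ/R)·det(∂_rγ,∂_tγ) = C_s·R·det = C_sκrR₀²/√u`.
[cite: LeeCerfon2015, §4.1 eq. (solo2)] -/
theorem hasDerivAt_lcTransportH {R₀ κ FB q₀ r : ℝ} (hR₀ : 0 < R₀) (hκ : 0 < κ) (hFB : 0 < FB)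
    (hq₀ : 0 < q₀) (hr : 0 < r) (h2r : 2 * r < R₀) (t : ℝ) :
    HasDerivAt (fun τ => lcTransportH κ FB R₀ q₀ r τ)
      (lcCurrentDr κ FB R₀ q₀ r t - csLC κ FB R₀ q₀ * (κ * r * R₀ ^ 2 / Real.sqrt (lcU R₀ r t))) t := by
  have hu := lcU_pos hR₀ hr.le h2r t
  have hq : 0 < Real.sqrt (lcU R₀ r t) := Real.sqrt_pos.2 hu
  -- elementary derivatives in `t`
  have hS := Real.hasDerivAt_sin t
  have hC := Real.hasDerivAt_cos t
  have hU := hasDerivAt_lcU R₀ r t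
  have hQ := hU.sqrt hu.ne'
  have hP : HasDerivAt (fun τ => lcU R₀ r τ * Real.cos τ + r * R₀ * Real.sin τ ^ 2)
      (-(2 * r * R₀ * Real.sin t) * Real.cos t + lcU R₀ r t * -Real.sin t
        + r * R₀ * (↑(2 : ℕ) * Real.sin t ^ (2 - 1) * Real.cos t)) t :=
    (hU.mul hC).add ((hS.pow 2).const_mul (r * R₀))
  have hW : HasDerivAt (fun τ => lcU R₀ r τ - r * R₀ * Real.cos τ)
      (-(2 * r * R₀ * Real.sin t) - r * R₀ * -Real.sin t) t :=
    hU.sub (hC.const_mul (r * R₀))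
  have hN : HasDerivAt (fun τ => κ * (lcU R₀ r τ * Real.cos τ + r * R₀ * Real.sin τ ^ 2)
        * (lcU R₀ r τ - r * R₀ * Real.cos τ) / lcU R₀ r τ ^ 2 - Real.cos τ / κ) _ t :=
    ((((hP.const_mul κ).mul hW).div (hU.pow 2)
      (by simp only [Pi.pow_apply]; positivity)).sub (hC.div_const κ))
  have hA : HasDerivAt (fun τ => 2 * (κ * FB / (2 * R₀ ^ 3 * q₀)) * r * R₀ ^ 2 * Real.sin τ)
      (2 * (κ * FB / (2 * R₀ ^ 3 * q₀)) * r * R₀ ^ 2 * Real.cos t) t := hS.const_mul _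
  have h := (hA.mul hN).div hQ hq.ne'
  refine h.congr_deriv ?_
  -- the algebra: expose the pointwise products, then eliminate `u = q²`, `sin² = 1 − cos²`,
  -- `cos t = (q² − R₀²)/(2rR₀)`
  simp only [Pi.mul_apply, Pi.pow_apply]
  norm_num
  have hκ0 : κ ≠ 0 := hκ.ne'
  have hFB0 : FB ≠ 0 := hFB.ne'
  have hq₀0 : q₀ ≠ 0 := hq₀.ne'
  have hR₀0 : R₀ ≠ 0 := hR₀.ne'
  have hr0 : r ≠ 0 := hr.ne'
  set q := Real.sqrt (lcU R₀ r t) with hq_def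
  have hq0 : q ≠ 0 := hq.ne'
  have hu' : lcU R₀ r t = q ^ 2 := by rw [hq_def, Real.sq_sqrt hu.le]
  have hcos : Real.cos t = (q ^ 2 - R₀ ^ 2) / (2 * r * R₀) := by
    have e : q ^ 2 = R₀ ^ 2 + 2 * r * R₀ * Real.cos t := by rw [← hu']; rfl
    field_simp
    linarith
  have hs2 : Real.sin t ^ 2 = 1 - Real.cos t ^ 2 := Real.sin_sq t
  have hs4 : Real.sin t ^ 4 = (1 - Real.cos t ^ 2) ^ 2 := by rw [← hs2]; ring
  unfold lcCurrentDr lcGradSqDr lcGradSq lcQKernelDr csLC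
  rw [hu', Real.sqrt_sq hq.le]
  field_simp
  ring_nf
  simp only [hs2, hs4]
  rw [hcos]
  field_simp
  ring

/-- `H` is `2π`-periodic in `t`; in particular `H(r, 2π) = H(r, 0)` (both vanish with `sin`).
[cite: LeeCerfon2015, §4.1 (boundary parametrisation)] -/
theorem lcTransportH_two_pi (κ FB R₀ q₀ r : ℝ) :
    lcTransportH κ FB R₀ q₀ r (2 * π) = lcTransportH κ FB R₀ q₀ r 0 := by
  unfold lcTransportH
  simp [Real.sin_two_pi, Real.sin_zero]

/-- Continuity of `t ↦ ∂_r f(r,t) − C_sκrR₀²/√u` on every surface `0 ≤ r < R₀/2`.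
[cite: Freidberg2014, §6.3.3 eq. (6.27)] -/
theorem continuous_lcCurrentDr_sub {R₀ κ FB q₀ r : ℝ} (hR₀ : 0 < R₀) (hκ : 0 < κ) (hFB : 0 < FB)
    (hq₀ : 0 < q₀) (hr : 0 ≤ r) (h2r : 2 * r < R₀) :
    Continuous fun t => lcCurrentDr κ FB R₀ q₀ r t
      - csLC κ FB R₀ q₀ * (κ * r * R₀ ^ 2 / Real.sqrt (lcU R₀ r t)) := by
  have hcU : Continuous (fun t => lcU R₀ r t) := by unfold lcU; fun_prop
  have hpos : ∀ t, 0 < lcU R₀ r t := lcU_pos hR₀ hr h2r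
  have hc : 0 < κ * FB / (2 * R₀ ^ 3 * q₀) := by positivity
  rw [continuous_iff_continuousAt]
  intro t
  have hu := hpos t
  have hs : 0 < Real.sqrt (lcU R₀ r t) := Real.sqrt_pos.2 hu
  unfold lcCurrentDr lcGradSqDr lcGradSq lcQKernelDr
  fun_prop (disch := positivity)

/-- **`∫₀^{2π} (∂_r f − C_sκrR₀²/√u) dt = 0`** (`= H(2π) − H(0)` by the transport identity and the
fundamental theorem of calculus). [cite: Freidberg2014, §6.3.3 eq. (6.27)] -/
theorem integral_lcCurrentDr_sub {R₀ κ FB q₀ r : ℝ} (hR₀ : 0 < R₀) (hκ : 0 < κ) (hFB : 0 < FB)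
    (hq₀ : 0 < q₀) (hr : 0 < r) (h2r : 2 * r < R₀) :
    ∫ t in (0 : ℝ)..(2 * π), (lcCurrentDr κ FB R₀ q₀ r t
        - csLC κ FB R₀ q₀ * (κ * r * R₀ ^ 2 / Real.sqrt (lcU R₀ r t))) = 0 := by
  rw [intervalIntegral.integral_eq_sub_of_hasDerivAt
    (fun t _ => hasDerivAt_lcTransportH hR₀ hκ hFB hq₀ hr h2r t)
    ((continuous_lcCurrentDr_sub hR₀ hκ hFB hq₀ hr.le h2r).intervalIntegrable _ _),
    lcTransportH_two_pi, sub_self]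

end Literature.MathematicalPhysics.MHD.Solovev
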